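import Summits.MatrixMultiplication.OmegaCensus.TriangleTorusShearedDefect
import Summits.MatrixMultiplication.OmegaCensus.CubeShiftedFormNoPartThree

/-!
# A part of size three forces `|A| + 3 ≤ 8·ord(w' − w)`; no coset part of size three over `Dih(ℤ_n²)` for EVERY `n` (kernel)

ω-census `pub-omega`, family (b3), seat pub-omega-group gen 34.  Framing: lottery ticket; floor = certified bounds/negative
ranges.  VALUE: the sharpened all-`A` theorem obtained from the exact defect identity `TriangleTorusShearedDefect.imbalance_le_sharp`
(`54·Δ ≤ 48n − 24` instead of `3·|Δ| ≤ 4n + 2`); NOT progress on ω; no census word changes.  It removes the two exceptions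
`n ∈ {8, 10}` of `ThreeSetNoPartThreeCorollaries` / `CubeShiftedFormNoPartThree` and improves the constant `12 → 8`:

* `card_sub_card_bound_sharp` — bridge: `54·(#T − #M) ≤ 48·ord v − 24` for a triangle tiling pulled back along
  `(c, j) ↦ c•u + j•v`.
* **`card_le_of_tiling_part_three_sharp`** — a 2:1 tiling of `A ∖ {z₀}` by translates of `±W`, `|W| = 3`, forces
  `|A| + 3 ≤ 8 · addOrderOf (w' − w)` for any two distinct `w, w' ∈ W`; hence the same for a part of size `3` of a cube
  SYMMETRIC form (`card_le_of_cube_form_part_three_sharp`) and of a cube SHIFTED form (`card_le_of_shifted_form_part_three_sharp`).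
* **`cube_form_no_part_three_zmod_sq_all`** — a cube symmetric form over `ℤ_n × ℤ_n` has no part of size `3`, EVERY `n`.
* **`cube_law_no_coset_part_three_sharp`** — `G` dihedral-like over ANY finite abelian `A` (any parity, any `c₀`), all element
  orders `≤ e` with `8e < |A| + 3`: a TPP triple with cube coset parts attaining `3|S||T||U| + 8 = 8|A|` has no coset part of size
  `3`; `…_of_exponent` (`8·exp A < |A| + 3`); **`cube_law_no_coset_part_three_zmod_sq_all`**: over `ℤ_n × ℤ_n` for EVERY `n`.
-/

namespace Summit.MatrixMultiplication.OmegaCensus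

open Finset TriangleTorus

section Bridge

variable {A : Type*} [AddCommGroup A] [DecidableEq A] [Fintype A]

/-- **Sharp bridge.**  For a triangle tiling of `A ∖ {z₀}` by translates of `±{0, u, v}` (`u, v` generating `A`, `3 ∤ ord v`):
`54·(#T − #M) ≤ 48·ord v − 24`. [folklore] -/
theorem card_sub_card_bound_sharp (u v : A) (hu : u ≠ 0) (hv : v ≠ 0) (huv : u ≠ v)
    (hgen : ∀ x : A, ∃ i k : ℤ, i • u + k • v = x) (h3 : ¬ 3 ∣ addOrderOf v) (T M : Finset A) (z₀ : A)
    (h : ∀ x, (M.filter fun m => m - x ∈ ({0, u, v} : Finset A)).card +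
      (T.filter fun t => x - t ∈ ({0, u, v} : Finset A)).card = if x = z₀ then 0 else 1) :
    54 * ((T.card : ℤ) - M.card) ≤ 48 * addOrderOf v - 24 := by
  classical
  have hex : ∃ a : ℕ, 0 < a ∧ (a : ℤ) • u ∈ AddSubgroup.zmultiples v :=
    ⟨addOrderOf u, addOrderOf_pos u, by rw [natCast_zsmul, addOrderOf_nsmul_eq_zero]; exact AddSubgroup.zero_mem _⟩
  obtain ⟨ha, hamem⟩ := Nat.find_spec hex
  set a := Nat.find hex with ha_def
  have hmin : ∀ b : ℕ, 0 < b → (b : ℤ) • u ∈ AddSubgroup.zmultiples v → a ≤ b :=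
    fun b hb hbm => Nat.find_min' hex ⟨hb, hbm⟩
  obtain ⟨k, hk⟩ := AddSubgroup.mem_zmultiples_iff.1 hamem
  have has : (a : ℤ) • u + (-k) • v = 0 := by rw [← hk, neg_zsmul, add_neg_cancel]
  have ha0 : (0 : ℤ) < a := by exact_mod_cast ha
  have hdiv : ∀ c : ℤ, c • u ∈ AddSubgroup.zmultiples v → (a : ℤ) ∣ c := by
    intro c hc
    have hr : (c % a) • u ∈ AddSubgroup.zmultiples v := by
      rw [show c % a = c - (c / a) * a by rw [Int.emod_def]; ring, sub_zsmul, mul_zsmul]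
      exact add_mem hc (neg_mem (AddSubgroup.zsmul_mem _ hamem _))
    by_contra hnd
    have hr0 : c % a ≠ 0 := fun h0 => hnd (Int.dvd_of_emod_eq_zero h0)
    have hrpos : 0 < c % a := lt_of_le_of_ne (Int.emod_nonneg _ ha0.ne') (Ne.symm hr0)
    have hrlt : c % a < a := Int.emod_lt_of_pos _ ha0
    have hle := hmin (c % a).toNat (by omega) (by rwa [Int.toNat_of_nonneg hrpos.le])
    omega
  have hdiv' : ∀ c j : ℤ, c • u + j • v = 0 → (a : ℤ) ∣ c := fun c j hcj =>
    hdiv c (AddSubgroup.mem_zmultiples_iff.2 ⟨-j, by rw [neg_zsmul]; exact neg_eq_of_add_eq_zero_left hcj⟩)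
  set F := shearedFactorOfFinsets u v a (-k) T M z₀ hu hv huv has hdiv' h with hF
  have hup : F.upCount = T.card := by
    unfold ShearedFactor.upCount
    simp only [hF, shearedFactorOfFinsets, decide_eq_true_eq]
    exact sum_sum_indicator_sheared u v z₀ a (-k) ha has hdiv hgen T
  have hdn : F.dnCount = M.card := by
    unfold ShearedFactor.dnCount
    simp only [hF, shearedFactorOfFinsets, decide_eq_true_eq]
    exact sum_sum_indicator_sheared u v z₀ a (-k) ha has hdiv hgen M
  have hhole : F.hole 0 0 = true := by simp [hF, shearedFactorOfFinsets]
  have hn2 : 2 ≤ addOrderOf v := by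
    have h1 : addOrderOf v ≠ 1 := fun h1 => hv (AddMonoid.addOrderOf_eq_one_iff.1 h1)
    have h0 := addOrderOf_pos v
    omega
  have := F.imbalance_le_sharp h3 hn2 ha 0 hhole
  rwa [hup, hdn] at this

/-- **Main theorem, sharp tiling form.**  If translates `m − W` (`m ∈ M`) and `t + W` (`t ∈ T`) of a three-element set `W`
partition `A ∖ {z₀}` with `|T| = 2|M|`, then `|A| + 3 ≤ 8 · addOrderOf (w' − w)` for any two distinct `w, w' ∈ W`. [folklore] -/
theorem card_le_of_tiling_part_three_sharp {W T M : Finset A} {z₀ : A}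
    (h : ∀ a, (M.filter fun m => m - a ∈ W).card + (T.filter fun t => a - t ∈ W).card = if a = z₀ then 0 else 1)
    (hW : W.card = 3) (hTM : T.card = 2 * M.card) {w w' : A} (hw : w ∈ W) (hw' : w' ∈ W) (hne : w ≠ w') :
    Fintype.card A + 3 ≤ 8 * addOrderOf (w' - w) := by
  classical
  obtain ⟨w'', hw''W, hw''w, hw''w'⟩ : ∃ w'' ∈ W, w'' ≠ w ∧ w'' ≠ w' := by
    have hc : ((W.erase w).erase w').card = 1 := by
      rw [card_erase_of_mem (mem_erase.2 ⟨hne.symm, hw'⟩), card_erase_of_mem hw, hW]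
    obtain ⟨w'', hw''⟩ := card_eq_one.1 hc
    have hm : w'' ∈ (W.erase w).erase w' := by rw [hw'']; exact mem_singleton_self _
    exact ⟨w'', (mem_erase.1 (mem_erase.1 hm).2).2, (mem_erase.1 (mem_erase.1 hm).2).1, (mem_erase.1 hm).1⟩
  set u : A := w'' - w with hu_def
  set v : A := w' - w with hv_def
  have hWeq : W = {w, w + u, w + v} := by
    rw [eq_triple_of_card_three hW hw hw''W hw' hw''w.symm hne hw''w', hu_def, hv_def, add_sub_cancel, add_sub_cancel]
  have hu : u ≠ 0 := sub_ne_zero.2 hw''w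
  have hv : v ≠ 0 := sub_ne_zero.2 hne.symm
  have huv : u ≠ v := fun e => hw''w' (sub_left_injective e)
  have h' := tiling_recentre hWeq h
  have hgen' := closure_eq_top_of_tiling hu hv huv h'
  have hgen : ∀ x : A, ∃ i k : ℤ, i • u + k • v = x := fun x =>
    AddSubgroup.mem_closure_pair.1 (by rw [hgen']; exact AddSubgroup.mem_top x)
  have hcount := tiling_count hu hv huv h'
  rw [card_image_of_injective _ (sub_left_injective), card_image_of_injective _ (add_left_injective w), hTM] at hcount
  have h3 : ¬ 3 ∣ addOrderOf v := by
    intro h3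
    have : 3 ∣ Fintype.card A := h3.trans addOrderOf_dvd_card
    omega
  have hb := card_sub_card_bound_sharp u v hu hv huv hgen h3 _ _ _ h'
  rw [card_image_of_injective _ (sub_left_injective), card_image_of_injective _ (add_left_injective w), hTM,
    Nat.cast_mul, show ((2 : ℕ) : ℤ) * (M.card : ℤ) - M.card = M.card by ring] at hb
  have hc' : (3 * (M.card + 2 * M.card) + 1 : ℤ) = Fintype.card A := by exact_mod_cast hcount
  have : (Fintype.card A : ℤ) + 3 ≤ 8 * addOrderOf v := by linarith
  exact_mod_cast this

/-- **Sharp form for the cube SYMMETRIC form**: `|W| = 3 ⇒ |A| + 3 ≤ 8 · addOrderOf (w' − w)`. [folklore] -/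
theorem card_le_of_cube_form_part_three_sharp {W X Y : Finset A} {x₀ : A}
    (h₁ : Set.InjOn (fun p : A × A × A => -p.1 + p.2.1 + p.2.2) ↑(W ×ˢ X ×ˢ Y))
    (h₂ : Set.InjOn (fun p : A × A × A => p.1 - p.2.1 + p.2.2) ↑(W ×ˢ X ×ˢ Y))
    (h₃ : Set.InjOn (fun p : A × A × A => p.1 + p.2.1 - p.2.2) ↑(W ×ˢ X ×ˢ Y))
    (d₁₂ : Disjoint ((W ×ˢ X ×ˢ Y).image fun p : A × A × A => -p.1 + p.2.1 + p.2.2)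
      ((W ×ˢ X ×ˢ Y).image fun p : A × A × A => p.1 - p.2.1 + p.2.2))
    (d₁₃ : Disjoint ((W ×ˢ X ×ˢ Y).image fun p : A × A × A => -p.1 + p.2.1 + p.2.2)
      ((W ×ˢ X ×ˢ Y).image fun p : A × A × A => p.1 + p.2.1 - p.2.2))
    (d₂₃ : Disjoint ((W ×ˢ X ×ˢ Y).image fun p : A × A × A => p.1 - p.2.1 + p.2.2)
      ((W ×ˢ X ×ˢ Y).image fun p : A × A × A => p.1 + p.2.1 - p.2.2))
    (hcover : ((W ×ˢ X ×ˢ Y).image fun p : A × A × A => -p.1 + p.2.1 + p.2.2) ∪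
      ((W ×ˢ X ×ˢ Y).image fun p : A × A × A => p.1 - p.2.1 + p.2.2) ∪
      ((W ×ˢ X ×ˢ Y).image fun p : A × A × A => p.1 + p.2.1 - p.2.2) = univ.erase x₀)
    (hW : W.card = 3) {w w' : A} (hw : w ∈ W) (hw' : w' ∈ W) (hne : w ≠ w') :
    Fintype.card A + 3 ≤ 8 * addOrderOf (w' - w) := by
  obtain ⟨htile, -, hM, hT⟩ := cube_form_tiling ⟨w, hw⟩ h₁ h₂ h₃ d₁₂ d₁₃ d₂₃ hcover
  exact card_le_of_tiling_part_three_sharp htile hW (by rw [hT, hM]) hw hw' hne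

/-- **Sharp form for the cube SHIFTED form** (any parity): `|W| = 3 ⇒ |A| + 3 ≤ 8 · addOrderOf (w' − w)`. [folklore] -/
theorem card_le_of_shifted_form_part_three_sharp {W X Y : Finset A} {κ₁ κ₂ κ₃ x₀ : A}
    (i₁ : Set.InjOn (fun p : A × A × A => p.1 + p.2.1 + p.2.2) ↑((W.image fun w => κ₁ - w) ×ˢ X ×ˢ Y))
    (i₂ : Set.InjOn (fun p : A × A × A => p.1 + p.2.1 + p.2.2) ↑(W ×ˢ (X.image fun x => κ₂ - x) ×ˢ Y))
    (i₃ : Set.InjOn (fun p : A × A × A => p.1 + p.2.1 + p.2.2) ↑(W ×ˢ X ×ˢ (Y.image fun y => κ₃ - y)))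
    (d₁₂ : Disjoint (((W.image fun w => κ₁ - w) ×ˢ X ×ˢ Y).image fun p : A × A × A => p.1 + p.2.1 + p.2.2)
      ((W ×ˢ (X.image fun x => κ₂ - x) ×ˢ Y).image fun p : A × A × A => p.1 + p.2.1 + p.2.2))
    (d₁₃ : Disjoint (((W.image fun w => κ₁ - w) ×ˢ X ×ˢ Y).image fun p : A × A × A => p.1 + p.2.1 + p.2.2)
      ((W ×ˢ X ×ˢ (Y.image fun y => κ₃ - y)).image fun p : A × A × A => p.1 + p.2.1 + p.2.2))
    (d₂₃ : Disjoint ((W ×ˢ (X.image fun x => κ₂ - x) ×ˢ Y).image fun p : A × A × A => p.1 + p.2.1 + p.2.2)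
      ((W ×ˢ X ×ˢ (Y.image fun y => κ₃ - y)).image fun p : A × A × A => p.1 + p.2.1 + p.2.2))
    (hcover : (((W.image fun w => κ₁ - w) ×ˢ X ×ˢ Y).image fun p : A × A × A => p.1 + p.2.1 + p.2.2) ∪
      ((W ×ˢ (X.image fun x => κ₂ - x) ×ˢ Y).image fun p : A × A × A => p.1 + p.2.1 + p.2.2) ∪
      ((W ×ˢ X ×ˢ (Y.image fun y => κ₃ - y)).image fun p : A × A × A => p.1 + p.2.1 + p.2.2) = univ.erase x₀)
    (hW : W.card = 3) {w w' : A} (hw : w ∈ W) (hw' : w' ∈ W) (hne : w ≠ w') :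
    Fintype.card A + 3 ≤ 8 * addOrderOf (w' - w) := by
  obtain ⟨htile, hM, hT⟩ := shifted_form_tiling ⟨w, hw⟩ i₁ i₂ i₃ d₁₂ d₁₃ d₂₃ hcover
  exact card_le_of_tiling_part_three_sharp htile hW (by rw [hT, hM]) hw hw' hne

/-- `|W| ≠ 3` in a three-set shifted form when all orders are `≤ e` with `8e < |A| + 3`. [folklore] -/
theorem shifted_form_card_ne_three_sharp {W X Y : Finset A} {κ₁ κ₂ κ₃ x₀ : A}
    (i₁ : Set.InjOn (fun p : A × A × A => p.1 + p.2.1 + p.2.2) ↑((W.image fun w => κ₁ - w) ×ˢ X ×ˢ Y))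
    (i₂ : Set.InjOn (fun p : A × A × A => p.1 + p.2.1 + p.2.2) ↑(W ×ˢ (X.image fun x => κ₂ - x) ×ˢ Y))
    (i₃ : Set.InjOn (fun p : A × A × A => p.1 + p.2.1 + p.2.2) ↑(W ×ˢ X ×ˢ (Y.image fun y => κ₃ - y)))
    (d₁₂ : Disjoint (((W.image fun w => κ₁ - w) ×ˢ X ×ˢ Y).image fun p : A × A × A => p.1 + p.2.1 + p.2.2)
      ((W ×ˢ (X.image fun x => κ₂ - x) ×ˢ Y).image fun p : A × A × A => p.1 + p.2.1 + p.2.2))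
    (d₁₃ : Disjoint (((W.image fun w => κ₁ - w) ×ˢ X ×ˢ Y).image fun p : A × A × A => p.1 + p.2.1 + p.2.2)
      ((W ×ˢ X ×ˢ (Y.image fun y => κ₃ - y)).image fun p : A × A × A => p.1 + p.2.1 + p.2.2))
    (d₂₃ : Disjoint ((W ×ˢ (X.image fun x => κ₂ - x) ×ˢ Y).image fun p : A × A × A => p.1 + p.2.1 + p.2.2)
      ((W ×ˢ X ×ˢ (Y.image fun y => κ₃ - y)).image fun p : A × A × A => p.1 + p.2.1 + p.2.2))
    (hcover : (((W.image fun w => κ₁ - w) ×ˢ X ×ˢ Y).image fun p : A × A × A => p.1 + p.2.1 + p.2.2) ∪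
      ((W ×ˢ (X.image fun x => κ₂ - x) ×ˢ Y).image fun p : A × A × A => p.1 + p.2.1 + p.2.2) ∪
      ((W ×ˢ X ×ˢ (Y.image fun y => κ₃ - y)).image fun p : A × A × A => p.1 + p.2.1 + p.2.2) = univ.erase x₀)
    (e : ℕ) (he : ∀ x : A, addOrderOf x ≤ e) (hA : 8 * e < Fintype.card A + 3) : W.card ≠ 3 := by
  intro hW
  obtain ⟨w, w', w'', hww', -, -, hWeq⟩ := card_eq_three.1 hW
  have hw : w ∈ W := by rw [hWeq]; simp
  have hw' : w' ∈ W := by rw [hWeq]; simp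
  have h := card_le_of_shifted_form_part_three_sharp i₁ i₂ i₃ d₁₂ d₁₃ d₂₃ hcover hW hw hw' hww'
  have := he (w' - w)
  omega

end Bridge

section Square

variable {n : ℕ} [NeZero n]

/-- **No part of size three over `ℤ_n × ℤ_n`, EVERY `n`** (kernel; the cases `n ∈ {8, 10}` left open by
`cube_form_no_part_three_zmod_sq` are closed by the sharp bound: `n ≥ 8 ⇒ n² + 3 > 8n`). [folklore] -/
theorem cube_form_no_part_three_zmod_sq_all {W X Y : Finset (ZMod n × ZMod n)} {x₀ : ZMod n × ZMod n}
    (h₁ : Set.InjOn (fun q : (ZMod n × ZMod n) × (ZMod n × ZMod n) × (ZMod n × ZMod n) => -q.1 + q.2.1 + q.2.2)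
      ↑(W ×ˢ X ×ˢ Y))
    (h₂ : Set.InjOn (fun q : (ZMod n × ZMod n) × (ZMod n × ZMod n) × (ZMod n × ZMod n) => q.1 - q.2.1 + q.2.2)
      ↑(W ×ˢ X ×ˢ Y))
    (h₃ : Set.InjOn (fun q : (ZMod n × ZMod n) × (ZMod n × ZMod n) × (ZMod n × ZMod n) => q.1 + q.2.1 - q.2.2)
      ↑(W ×ˢ X ×ˢ Y))
    (d₁₂ : Disjoint ((W ×ˢ X ×ˢ Y).image fun q => -q.1 + q.2.1 + q.2.2) ((W ×ˢ X ×ˢ Y).image fun q => q.1 - q.2.1 + q.2.2))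
    (d₁₃ : Disjoint ((W ×ˢ X ×ˢ Y).image fun q => -q.1 + q.2.1 + q.2.2) ((W ×ˢ X ×ˢ Y).image fun q => q.1 + q.2.1 - q.2.2))
    (d₂₃ : Disjoint ((W ×ˢ X ×ˢ Y).image fun q => q.1 - q.2.1 + q.2.2) ((W ×ˢ X ×ˢ Y).image fun q => q.1 + q.2.1 - q.2.2))
    (hcover : ((W ×ˢ X ×ˢ Y).image fun q => -q.1 + q.2.1 + q.2.2) ∪ ((W ×ˢ X ×ˢ Y).image fun q => q.1 - q.2.1 + q.2.2) ∪
      ((W ×ˢ X ×ˢ Y).image fun q => q.1 + q.2.1 - q.2.2) = univ.erase x₀) :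
    W.card ≠ 3 ∧ X.card ≠ 3 ∧ Y.card ≠ 3 := by
  by_cases h8 : 8 ≤ n
  · have hcard : Fintype.card (ZMod n × ZMod n) = n * n := by rw [Fintype.card_prod, ZMod.card]
    have key : ∀ {W' X' Y' : Finset (ZMod n × ZMod n)} {x₀' : ZMod n × ZMod n},
        Set.InjOn (fun q : (ZMod n × ZMod n) × (ZMod n × ZMod n) × (ZMod n × ZMod n) => -q.1 + q.2.1 + q.2.2)
          ↑(W' ×ˢ X' ×ˢ Y') →
        Set.InjOn (fun q : (ZMod n × ZMod n) × (ZMod n × ZMod n) × (ZMod n × ZMod n) => q.1 - q.2.1 + q.2.2)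
          ↑(W' ×ˢ X' ×ˢ Y') →
        Set.InjOn (fun q : (ZMod n × ZMod n) × (ZMod n × ZMod n) × (ZMod n × ZMod n) => q.1 + q.2.1 - q.2.2)
          ↑(W' ×ˢ X' ×ˢ Y') →
        Disjoint ((W' ×ˢ X' ×ˢ Y').image fun q => -q.1 + q.2.1 + q.2.2)
          ((W' ×ˢ X' ×ˢ Y').image fun q => q.1 - q.2.1 + q.2.2) →
        Disjoint ((W' ×ˢ X' ×ˢ Y').image fun q => -q.1 + q.2.1 + q.2.2)
          ((W' ×ˢ X' ×ˢ Y').image fun q => q.1 + q.2.1 - q.2.2) →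
        Disjoint ((W' ×ˢ X' ×ˢ Y').image fun q => q.1 - q.2.1 + q.2.2)
          ((W' ×ˢ X' ×ˢ Y').image fun q => q.1 + q.2.1 - q.2.2) →
        ((W' ×ˢ X' ×ˢ Y').image fun q => -q.1 + q.2.1 + q.2.2) ∪ ((W' ×ˢ X' ×ˢ Y').image fun q => q.1 - q.2.1 + q.2.2) ∪
          ((W' ×ˢ X' ×ˢ Y').image fun q => q.1 + q.2.1 - q.2.2) = univ.erase x₀' → W'.card ≠ 3 := by
      intro W' X' Y' x₀' j₁ j₂ j₃ g₁₂ g₁₃ g₂₃ gcov hW'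
      obtain ⟨w, w', w'', hww', -, -, hWeq⟩ := card_eq_three.1 hW'
      have hw : w ∈ W' := by rw [hWeq]; simp
      have hw' : w' ∈ W' := by rw [hWeq]; simp
      have h := card_le_of_cube_form_part_three_sharp j₁ j₂ j₃ g₁₂ g₁₃ g₂₃ gcov hW' hw hw' hww'
      have ho := addOrderOf_le_of_zmod_sq (w' - w)
      rw [hcard] at h
      nlinarith
    obtain ⟨i₁, i₂, i₃, e₁₂, e₁₃, e₂₃, ecov⟩ := cube_symmetric_form_rotate h₁ h₂ h₃ d₁₂ d₁₃ d₂₃ hcover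
    obtain ⟨j₁, j₂, j₃, f₁₂, f₁₃, f₂₃, fcov⟩ := cube_symmetric_form_rotate i₁ i₂ i₃ e₁₂ e₁₃ e₂₃ ecov
    exact ⟨key h₁ h₂ h₃ d₁₂ d₁₃ d₂₃ hcover, key i₁ i₂ i₃ e₁₂ e₁₃ e₂₃ ecov, key j₁ j₂ j₃ f₁₂ f₁₃ f₂₃ fcov⟩
  · exact cube_form_no_part_three_zmod_sq (by omega) (by omega) h₁ h₂ h₃ d₁₂ d₁₃ d₂₃ hcover

end Square

section Law

open Literature.Combinatorics.Additive

variable {A : Type} [AddCommGroup A] [DecidableEq A] [Fintype A] {G : Type} [Group G] [DecidableEq G]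
  {ρ τ : A → G} {c₀ : A} {S T U : Finset G}

/-- The first coset part, sharp form. [folklore] -/
theorem cube_law_first_coset_part_ne_three_sharp
    (hρρ : ∀ a b, ρ a * ρ b = ρ (a + b)) (hρτ : ∀ a b, ρ a * τ b = τ (b - a))
    (hτρ : ∀ a b, τ a * ρ b = τ (a + b)) (hττ : ∀ a b, τ a * τ b = ρ (c₀ + b - a))
    (hρ : Function.Injective ρ) (hτ : Function.Injective τ) (hne : ∀ a b, ρ a ≠ τ b)
    (hsurj : ∀ g, (∃ a, ρ a = g) ∨ (∃ a, τ a = g))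
    (h : TripleProductProperty S T U)
    (hS : (univ.filter fun a : A => ρ a ∈ S).card = (univ.filter fun a : A => τ a ∈ S).card)
    (hT : (univ.filter fun a : A => ρ a ∈ T).card = (univ.filter fun a : A => τ a ∈ T).card)
    (hU : (univ.filter fun a : A => ρ a ∈ U).card = (univ.filter fun a : A => τ a ∈ U).card)
    (hV : 3 * (S.card * T.card * U.card) + 8 = 8 * Fintype.card A)
    (e : ℕ) (he : ∀ x : A, addOrderOf x ≤ e) (hA : 8 * e < Fintype.card A + 3) :
    (univ.filter fun a : A => ρ a ∈ S).card ≠ 3 := by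
  obtain ⟨W, X, Y, κ₁, κ₂, κ₃, x₀, cW, -, -, -, i₁, i₂, i₃, d₁₂, d₁₃, d₂₃, hcover⟩ :=
    cube_shifted_form_of_law hρρ hρτ hτρ hττ hρ hτ hne hsurj h hS hT hU hV
  rw [← cW]
  exact shifted_form_card_ne_three_sharp i₁ i₂ i₃ d₁₂ d₁₃ d₂₃ hcover e he hA

/-- **No coset part of size three, sharp form** (kernel).  `G` dihedral-like over ANY finite abelian `A` (any parity, any
`c₀`); every element of `A` of order `≤ e` with `8e < |A| + 3`.  Then a TPP triple with cube coset parts attaining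
`3|S||T||U| + 8 = 8|A|` has `|S₀|, |T₀|, |U₀| ≠ 3`. [folklore] -/
theorem cube_law_no_coset_part_three_sharp
    (hρρ : ∀ a b, ρ a * ρ b = ρ (a + b)) (hρτ : ∀ a b, ρ a * τ b = τ (b - a))
    (hτρ : ∀ a b, τ a * ρ b = τ (a + b)) (hττ : ∀ a b, τ a * τ b = ρ (c₀ + b - a))
    (hρ : Function.Injective ρ) (hτ : Function.Injective τ) (hne : ∀ a b, ρ a ≠ τ b)
    (hsurj : ∀ g, (∃ a, ρ a = g) ∨ (∃ a, τ a = g))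
    (h : TripleProductProperty S T U)
    (hS : (univ.filter fun a : A => ρ a ∈ S).card = (univ.filter fun a : A => τ a ∈ S).card)
    (hT : (univ.filter fun a : A => ρ a ∈ T).card = (univ.filter fun a : A => τ a ∈ T).card)
    (hU : (univ.filter fun a : A => ρ a ∈ U).card = (univ.filter fun a : A => τ a ∈ U).card)
    (hV : 3 * (S.card * T.card * U.card) + 8 = 8 * Fintype.card A)
    (e : ℕ) (he : ∀ x : A, addOrderOf x ≤ e) (hA : 8 * e < Fintype.card A + 3) :
    (univ.filter fun a : A => ρ a ∈ S).card ≠ 3 ∧ (univ.filter fun a : A => ρ a ∈ T).card ≠ 3 ∧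
      (univ.filter fun a : A => ρ a ∈ U).card ≠ 3 := by
  have hV' : 3 * (T.card * U.card * S.card) + 8 = 8 * Fintype.card A := by rw [← hV]; ring
  have hV'' : 3 * (U.card * S.card * T.card) + 8 = 8 * Fintype.card A := by rw [← hV]; ring
  exact ⟨cube_law_first_coset_part_ne_three_sharp hρρ hρτ hτρ hττ hρ hτ hne hsurj h hS hT hU hV e he hA,
    cube_law_first_coset_part_ne_three_sharp hρρ hρτ hτρ hττ hρ hτ hne hsurj h.rotate hT hU hS hV' e he hA,
    cube_law_first_coset_part_ne_three_sharp hρρ hρτ hτρ hττ hρ hτ hne hsurj h.rotate.rotate hU hS hT hV'' e he hA⟩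

/-- **Exponent form** (sharp): `8·exp(A) < |A| + 3` ⇒ no coset part of size `3`. [folklore] -/
theorem cube_law_no_coset_part_three_sharp_of_exponent
    (hρρ : ∀ a b, ρ a * ρ b = ρ (a + b)) (hρτ : ∀ a b, ρ a * τ b = τ (b - a))
    (hτρ : ∀ a b, τ a * ρ b = τ (a + b)) (hττ : ∀ a b, τ a * τ b = ρ (c₀ + b - a))
    (hρ : Function.Injective ρ) (hτ : Function.Injective τ) (hne : ∀ a b, ρ a ≠ τ b)
    (hsurj : ∀ g, (∃ a, ρ a = g) ∨ (∃ a, τ a = g))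
    (h : TripleProductProperty S T U)
    (hS : (univ.filter fun a : A => ρ a ∈ S).card = (univ.filter fun a : A => τ a ∈ S).card)
    (hT : (univ.filter fun a : A => ρ a ∈ T).card = (univ.filter fun a : A => τ a ∈ T).card)
    (hU : (univ.filter fun a : A => ρ a ∈ U).card = (univ.filter fun a : A => τ a ∈ U).card)
    (hV : 3 * (S.card * T.card * U.card) + 8 = 8 * Fintype.card A)
    (hA : 8 * AddMonoid.exponent A < Fintype.card A + 3) :
    (univ.filter fun a : A => ρ a ∈ S).card ≠ 3 ∧ (univ.filter fun a : A => ρ a ∈ T).card ≠ 3 ∧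
      (univ.filter fun a : A => ρ a ∈ U).card ≠ 3 :=
  cube_law_no_coset_part_three_sharp hρρ hρτ hτρ hττ hρ hτ hne hsurj h hS hT hU hV (AddMonoid.exponent A)
    (fun x => AddMonoid.addOrderOf_le_exponent AddMonoid.ExponentExists.of_finite x) hA

end Law

section SquareLaw

open Literature.Combinatorics.Additive

variable {n : ℕ} [NeZero n] {G : Type} [Group G] [DecidableEq G] {ρ τ : ZMod n × ZMod n → G}
  {c₀ : ZMod n × ZMod n} {S T U : Finset G}

/-- The first coset part over `ℤ_n × ℤ_n`, every `n`. [folklore] -/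
theorem cube_law_first_coset_part_ne_three_zmod_sq_all
    (hρρ : ∀ a b, ρ a * ρ b = ρ (a + b)) (hρτ : ∀ a b, ρ a * τ b = τ (b - a))
    (hτρ : ∀ a b, τ a * ρ b = τ (a + b)) (hττ : ∀ a b, τ a * τ b = ρ (c₀ + b - a))
    (hρ : Function.Injective ρ) (hτ : Function.Injective τ) (hne : ∀ a b, ρ a ≠ τ b)
    (hsurj : ∀ g, (∃ a, ρ a = g) ∨ (∃ a, τ a = g))
    (h : TripleProductProperty S T U)
    (hS : (univ.filter fun a : ZMod n × ZMod n => ρ a ∈ S).card =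
      (univ.filter fun a : ZMod n × ZMod n => τ a ∈ S).card)
    (hT : (univ.filter fun a : ZMod n × ZMod n => ρ a ∈ T).card =
      (univ.filter fun a : ZMod n × ZMod n => τ a ∈ T).card)
    (hU : (univ.filter fun a : ZMod n × ZMod n => ρ a ∈ U).card =
      (univ.filter fun a : ZMod n × ZMod n => τ a ∈ U).card)
    (hV : 3 * (S.card * T.card * U.card) + 8 = 8 * Fintype.card (ZMod n × ZMod n)) :
    (univ.filter fun a : ZMod n × ZMod n => ρ a ∈ S).card ≠ 3 := by
  have hcard : Fintype.card (ZMod n × ZMod n) = n * n := by rw [Fintype.card_prod, ZMod.card]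
  by_cases h8 : 8 ≤ n
  · exact cube_law_first_coset_part_ne_three_sharp hρρ hρτ hτρ hττ hρ hτ hne hsurj h hS hT hU hV n
      addOrderOf_le_of_zmod_sq (by rw [hcard]; nlinarith)
  · exact cube_law_first_coset_part_ne_three_zmod_sq (by omega) (by omega) hρρ hρτ hτρ hττ hρ hτ hne hsurj h hS hT hU hV

/-- **No coset part of size three in a cube law triple over `Dih(ℤ_n²)`, EVERY `n`** (kernel; any parity, any presentation
constant `c₀`): if `G` is dihedral-like over `ℤ_n × ℤ_n` and a TPP triple `(S, T, U)` of `G` has cube coset parts and attains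
`3|S||T||U| + 8 = 8n²`, then no coset part has size `3`. [folklore] -/
theorem cube_law_no_coset_part_three_zmod_sq_all
    (hρρ : ∀ a b, ρ a * ρ b = ρ (a + b)) (hρτ : ∀ a b, ρ a * τ b = τ (b - a))
    (hτρ : ∀ a b, τ a * ρ b = τ (a + b)) (hττ : ∀ a b, τ a * τ b = ρ (c₀ + b - a))
    (hρ : Function.Injective ρ) (hτ : Function.Injective τ) (hne : ∀ a b, ρ a ≠ τ b)
    (hsurj : ∀ g, (∃ a, ρ a = g) ∨ (∃ a, τ a = g))
    (h : TripleProductProperty S T U)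
    (hS : (univ.filter fun a : ZMod n × ZMod n => ρ a ∈ S).card =
      (univ.filter fun a : ZMod n × ZMod n => τ a ∈ S).card)
    (hT : (univ.filter fun a : ZMod n × ZMod n => ρ a ∈ T).card =
      (univ.filter fun a : ZMod n × ZMod n => τ a ∈ T).card)
    (hU : (univ.filter fun a : ZMod n × ZMod n => ρ a ∈ U).card =
      (univ.filter fun a : ZMod n × ZMod n => τ a ∈ U).card)
    (hV : 3 * (S.card * T.card * U.card) + 8 = 8 * Fintype.card (ZMod n × ZMod n)) :
    (univ.filter fun a : ZMod n × ZMod n => ρ a ∈ S).card ≠ 3 ∧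
      (univ.filter fun a : ZMod n × ZMod n => ρ a ∈ T).card ≠ 3 ∧
      (univ.filter fun a : ZMod n × ZMod n => ρ a ∈ U).card ≠ 3 := by
  have hV' : 3 * (T.card * U.card * S.card) + 8 = 8 * Fintype.card (ZMod n × ZMod n) := by rw [← hV]; ring
  have hV'' : 3 * (U.card * S.card * T.card) + 8 = 8 * Fintype.card (ZMod n × ZMod n) := by rw [← hV]; ring
  exact ⟨cube_law_first_coset_part_ne_three_zmod_sq_all hρρ hρτ hτρ hττ hρ hτ hne hsurj h hS hT hU hV,
    cube_law_first_coset_part_ne_three_zmod_sq_all hρρ hρτ hτρ hττ hρ hτ hne hsurj h.rotate hT hU hS hV',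
    cube_law_first_coset_part_ne_three_zmod_sq_all hρρ hρτ hτρ hττ hρ hτ hne hsurj h.rotate.rotate hU hS hT hV''⟩

end SquareLaw

end Summit.MatrixMultiplication.OmegaCensus
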